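import Summits.BirchSwinnertonDyer.Rank1Residual.GaloisImage.WildShapeValuation
import HarnessLib

/-!
# Valuations of the `3`-torsion abscissae on a WILD normal-shape equation at `3`:
# the canonical / non-canonical dichotomy
# (cell `b2b-bsdres`, team n1011, seat p02 gen 3, OWNERS row T-b10 'wild tower at 3', file F1b)

HONEST FRAMING (cell `b2b-bsdres`, run/shared/lean/b2b/bsd-rank1-residual/, verbatim in every
file): the goal of the cell is to DELETE the COMBINATION-SHAPED residual classes of the
Birch–Swinnerton-Dyer formula for ALL analytic-rank `≤ 1` elliptic curves over `ℚ` — "full BSD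
formula for every rank `≤ 1` curve in class `C`" assembled STRICTLY from published theorems — so
that the rank-`≤ 1` remainder becomes exactly the CONSTRUCTION-SHAPED classes, which are TYPED
(missing-input `Prop`s), NOT attempted. This is not "finishing BSD". Team n1011 (N10 / N11, the
additive block X4 ∧ `p = 3`): research route on the CONSTRUCTION-SHAPED class X4; no claim beyond the
stated classes; nothing is booked. Theorems only (no definition, no named fact).

## What this file proves (`v` = the place over `3`, `t = v(3)`; normal shape
`a₁ = a₃ = a₆ = 0`, `a₄ = 1`, `v(a₂)⁶ = t^m`, see `WildShapeValuation`)

* `valuation_dichotomy_of_isRoot_Ψ₃_wild` — every root `ξ` of `ψ₃ = 3X⁴ + 4a₂X³ + 6X² − 1`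
  satisfies `v(ξ)¹⁸·t^m = 1` (NON-CANONICAL, valuation `−m/18`) or `v(ξ)⁶·t^{6−m} = 1`
  (CANONICAL, valuation `(m − 6)/6`), for `1 ≤ m ≤ 4` (dominant terms `3ξ⁴` / `4a₂ξ³` / `−1` in
  the three excluded regimes);
* `exists_isRoot_Ψ₃_wild` — SOME root is non-canonical (`ψ₃ = 3∏(X − ξᵢ)` over `ℚ̄`,
  `ψ₃(0) = −1`, so `t·∏v(ξᵢ) = 1`; four canonical roots would force `t⁶ = t^{24−4m}`).

This is the Newton polygon of `[3]` on the height-`2` formal group of the good supersingular model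
(Hasse valuation `m/6 < 3/4`: a canonical subgroup of order `3` and six points of valuation
`m/36`), read through the `3`-division polynomial.  Step S1 of `cells/n1011/skel/T-b10-wild-tower.md`;
no tower claimed here.

References: N. Katz (1973) §3.10; J.-P. Serre, Invent. Math. 15 (1972) §1; Silverman *AEC* Ex. 3.7.
-/

noncomputable section

-- Exponents up to `162` occur on elements of the value group `(placeOver 3).ValueGroup` (a
-- quotient type on which numerals `x ^ 162` are unfolded by `whnf` during unification); the
-- default recursion depth (512) does not suffice for that unfolding.  Nothing else is affected.
set_option maxRecDepth 10000

open scoped Classical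

open Polynomial WeierstrassCurve

namespace Summit.BirchSwinnertonDyer.Rank1Residual.GaloisImage

open Literature.NumberTheory.EllipticCurves

variable (W : WeierstrassCurve (AlgebraicClosure ℚ))

/-! ### §2 The `3`-torsion abscissae: canonical / non-canonical dichotomy -/

section Three

variable {W}

/-- **§2. Valuations of the roots of `ψ₃ = 3X⁴ + 4a₂X³ + 6X² − 1`** (normal shape,
`v(a₂)⁶ = v(3)^m`, `1 ≤ m ≤ 4`): every root `ξ` has `v(ξ)¹⁸·v(3)^m = 1` (three NON-CANONICAL
abscissae, valuation `−m/18`) or `v(ξ)⁶·v(3)^{6−m} = 1` (the CANONICAL one, valuation `(m − 6)/6`).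
Dominant terms: `3ξ⁴` above the canonical valuation, `4a₂ξ³` between, `−1` below. [folklore] -/
theorem valuation_dichotomy_of_isRoot_Ψ₃_wild (h1 : W.a₁ = 0) (h3 : W.a₃ = 0) (h4 : W.a₄ = 1)
    (h6 : W.a₆ = 0) {m : ℕ} (hm1 : 1 ≤ m) (hm4 : m ≤ 4)
    (hα : (placeOver 3).valuation W.a₂ ^ 6 = (placeOver 3).valuation (3 : AlgebraicClosure ℚ) ^ m)
    {x : AlgebraicClosure ℚ} (hx : W.Ψ₃.IsRoot x) :
    (placeOver 3).valuation x ^ 18 * (placeOver 3).valuation (3 : AlgebraicClosure ℚ) ^ m = 1 ∨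
      (placeOver 3).valuation x ^ 6 *
        (placeOver 3).valuation (3 : AlgebraicClosure ℚ) ^ (6 - m) = 1 := by
  set v := (placeOver 3).valuation with hv
  set t := v (3 : AlgebraicClosure ℚ) with ht
  have ht1 : t < 1 := valuation_three_lt_one
  have ht0 : t ≠ 0 := valuation_three_ne_zero
  have htpos : 0 < t := zero_lt_iff.mpr ht0
  set α := v W.a₂ with hαdef
  set u := v x with hu
  have heval : 3 * x ^ 4 + 4 * W.a₂ * x ^ 3 + 6 * x ^ 2 - 1 = 0 := by
    have := hx; rwa [IsRoot.def, eval_Ψ₃_of_shape h1 h3 h4 h6] at this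
  have h4' : v (4 : AlgebraicClosure ℚ) = 1 := by
    simpa using valuation_intCast_eq_one_of_not_dvd (n := 4) (by decide)
  have h6' : v (6 : AlgebraicClosure ℚ) = t := by
    rw [show (6 : AlgebraicClosure ℚ) = 2 * 3 by norm_num, map_mul]
    have h2 : v (2 : AlgebraicClosure ℚ) = 1 := by
      simpa using valuation_intCast_eq_one_of_not_dvd (n := 2) (by decide)
    rw [h2, one_mul]
  -- the four term valuations
  have hD4 : v (3 * x ^ 4) = t * u ^ 4 := by rw [map_mul, map_pow]
  have hD3 : v (4 * W.a₂ * x ^ 3) = α * u ^ 3 := by rw [map_mul, map_mul, h4', one_mul, map_pow]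
  have hD2 : v (6 * x ^ 2) = t * u ^ 2 := by rw [map_mul, h6', map_pow]
  have hD0 : v (1 : AlgebraicClosure ℚ) = 1 := map_one v
  have htm6 : t ^ m * t ^ (6 - m) = t ^ 6 := by rw [← pow_add, Nat.add_sub_cancel' (by omega)]
  -- the two tests
  set T2 := u ^ 6 * t ^ (6 - m) with hT2
  set T1 := u ^ 18 * t ^ m with hT1
  have hT1eq : (α * u ^ 3) ^ 6 = T1 := by rw [mul_pow, hα, ← pow_mul, mul_comm]
  rcases lt_trichotomy 1 T2 with hgt2 | heq2 | hlt2
  · -- (a) `3ξ⁴` dominates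
    exfalso
    have hu0 : u ≠ 0 := by
      rintro h0; rw [hT2, h0, zero_pow (by norm_num), zero_mul] at hgt2; exact not_lt_zero hgt2
    have hu6 : 1 < u ^ 6 := by
      refine lt_of_lt_of_le hgt2 ?_
      calc T2 = u ^ 6 * t ^ (6 - m) := rfl
        _ ≤ u ^ 6 * 1 := mul_le_mul' le_rfl (pow_le_one₀ zero_le ht1.le)
        _ = u ^ 6 := mul_one _
    have hu1 : 1 < u := by
      by_contra hle; rw [not_lt] at hle
      exact absurd hu6 (not_lt.mpr (pow_le_one₀ zero_le hle))
    have hi : α * u ^ 3 < t * u ^ 4 := by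
      have hαtu : α < t * u := by
        refine lt_of_pow_lt_pow_left₀ 6 zero_le ?_
        rw [hα, mul_pow]
        calc t ^ m = t ^ m * 1 := (mul_one _).symm
          _ < t ^ m * T2 := mul_lt_mul_left_of_ne_zero (pow_ne_zero _ ht0) hgt2
          _ = t ^ 6 * u ^ 6 := by rw [hT2, mul_comm (u ^ 6), ← mul_assoc, htm6]
      calc α * u ^ 3 < t * u * u ^ 3 := mul_lt_mul_right_of_ne_zero' (pow_ne_zero _ hu0) hαtu
        _ = t * u ^ 4 := by rw [mul_assoc, ← pow_succ']
    have hii : t * u ^ 2 < t * u ^ 4 := by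
      refine mul_lt_mul_left_of_ne_zero ht0 ?_
      calc u ^ 2 = u ^ 2 * 1 := (mul_one _).symm
        _ < u ^ 2 * u ^ 2 := mul_lt_mul_left_of_ne_zero (pow_ne_zero _ hu0) (one_lt_pow₀ hu1 two_ne_zero)
        _ = u ^ 4 := by rw [← pow_add]
    have hiii : (1 : _) < t * u ^ 4 := by
      by_contra hle; rw [not_lt] at hle
      have h6le : (t * u ^ 4) ^ 6 ≤ 1 := pow_le_one₀ zero_le hle
      have hT24 : 1 < T2 ^ 4 := one_lt_pow₀ hgt2 (by norm_num)
      have key : T2 ^ 4 ≤ (t * u ^ 4) ^ 6 := by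
        rw [hT2, mul_pow, mul_pow, ← pow_mul, ← pow_mul, ← pow_mul, mul_comm]
        exact mul_le_mul' (pow_le_pow_of_le_one' ht1.le (by omega)) le_rfl
      exact absurd (hT24.trans_le (key.trans h6le)) (lt_irrefl _)
    have hr : v (4 * W.a₂ * x ^ 3 + 6 * x ^ 2 - 1) < v (3 * x ^ 4) := by
      rw [hD4]
      refine Valuation.map_sub_lt _ (Valuation.map_add_lt _ ?_ ?_) ?_
      · rwa [hD3]
      · rwa [hD2]
      · rwa [hD0]
    refine false_of_dominant v ?_ hr
    rw [← heval]; ring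
  · exact Or.inr heq2.symm
  · rcases lt_trichotomy 1 T1 with hgt1 | heq1 | hlt1
    · -- (c) `4a₂ξ³` dominates
      exfalso
      have hu0 : u ≠ 0 := by
        rintro h0; rw [hT1, h0, zero_pow (by norm_num), zero_mul] at hgt1; exact not_lt_zero hgt1
      have hi : t * u ^ 4 < α * u ^ 3 := by
        have htuα : t * u < α := by
          refine lt_of_pow_lt_pow_left₀ 6 zero_le ?_
          rw [hα, mul_pow]
          calc t ^ 6 * u ^ 6 = t ^ m * T2 := by rw [hT2, mul_comm (u ^ 6), ← mul_assoc, htm6]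
            _ < t ^ m * 1 := mul_lt_mul_left_of_ne_zero (pow_ne_zero _ ht0) hlt2
            _ = t ^ m := mul_one _
        calc t * u ^ 4 = t * u * u ^ 3 := by rw [mul_assoc, ← pow_succ']
          _ < α * u ^ 3 := mul_lt_mul_right_of_ne_zero' (pow_ne_zero _ hu0) htuα
      have hii : t * u ^ 2 < α * u ^ 3 := by
        have htαu : t < α * u := by
          refine lt_of_pow_lt_pow_left₀ 18 zero_le ?_
          have e : (α * u) ^ 18 = t ^ (m + m) * T1 := by
            have h18 : α ^ 18 = t ^ (m + m) * t ^ m := by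
              rw [show (18 : ℕ) = 6 * 3 by norm_num, pow_mul, hα, ← pow_mul, ← pow_add]
              congr 1; omega
            rw [mul_pow, h18, hT1, mul_assoc, mul_comm (t ^ m) (u ^ 18)]
          rw [e]
          calc t ^ 18 ≤ t ^ (m + m) := pow_le_pow_of_le_one' ht1.le (by omega)
            _ = t ^ (m + m) * 1 := (mul_one _).symm
            _ < t ^ (m + m) * T1 := mul_lt_mul_left_of_ne_zero (pow_ne_zero _ ht0) hgt1
        calc t * u ^ 2 < α * u * u ^ 2 := mul_lt_mul_right_of_ne_zero' (pow_ne_zero _ hu0) htαu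
          _ = α * u ^ 3 := by rw [mul_assoc, ← pow_succ']
      have hiii : (1 : _) < α * u ^ 3 := by
        refine lt_of_pow_lt_pow_left₀ 6 zero_le ?_
        rwa [one_pow, hT1eq]
      have hr : v (3 * x ^ 4 + 6 * x ^ 2 - 1) < v (4 * W.a₂ * x ^ 3) := by
        rw [hD3]
        refine Valuation.map_sub_lt _ (Valuation.map_add_lt _ ?_ ?_) ?_
        · rwa [hD4]
        · rwa [hD2]
        · rwa [hD0]
      refine false_of_dominant v ?_ hr
      rw [← heval]; ring
    · exact Or.inl heq1.symm
    · -- (e) `−1` dominates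
      exfalso
      have hi : α * u ^ 3 < 1 := by
        refine lt_of_pow_lt_pow_left₀ 6 zero_le ?_
        rwa [one_pow, hT1eq]
      have hii : t * u ^ 2 < 1 := by
        refine lt_of_pow_lt_pow_left₀ 9 zero_le ?_
        have e : (t * u ^ 2) ^ 9 = t ^ (9 - m) * T1 := by
          have h9 : t ^ 9 = t ^ (9 - m) * t ^ m := by
            rw [← pow_add]; congr 1; omega
          have h18 : (u ^ 2) ^ 9 = u ^ 18 := by rw [← pow_mul]
          rw [mul_pow, h9, h18, hT1]; ac_rfl
        rw [e, one_pow]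
        exact mul_lt_one_of_nonneg_of_lt_one_right (pow_le_one₀ zero_le ht1.le) zero_le hlt1
      have hiii : t * u ^ 4 < 1 := by
        refine lt_of_pow_lt_pow_left₀ 9 zero_le ?_
        have e : (t * u ^ 4) ^ 9 = t ^ (9 - 2 * m) * (T1 * T1) := by
          have h9 : t ^ 9 = t ^ (9 - 2 * m) * (t ^ m * t ^ m) := by
            rw [← pow_add, ← pow_add]; congr 1; omega
          have h36 : (u ^ 4) ^ 9 = u ^ 18 * u ^ 18 := by rw [← pow_mul, ← pow_add]
          rw [mul_pow, h9, h36, hT1]; ac_rfl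
        rw [e, one_pow]
        exact mul_lt_one_of_nonneg_of_lt_one_right (pow_le_one₀ zero_le ht1.le) zero_le
          (mul_lt_one_of_nonneg_of_lt_one_right hlt1.le zero_le hlt1)
      have hr : v (3 * x ^ 4 + 4 * W.a₂ * x ^ 3 + 6 * x ^ 2) < v (-1 : AlgebraicClosure ℚ) := by
        rw [Valuation.map_neg, hD0]
        refine Valuation.map_add_lt _ (Valuation.map_add_lt _ ?_ ?_) ?_
        · rwa [hD4]
        · rwa [hD3]
        · rwa [hD2]
      refine false_of_dominant v ?_ hr
      rw [← heval]; ring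

/-- **§2. Some root of `ψ₃` is non-canonical**: in normal shape with `v(a₂)⁶ = v(3)^m`,
`1 ≤ m ≤ 4`, there is a root `ξ` of `ψ₃` with `v(ξ)¹⁸·v(3)^m = 1`.  Indeed `ψ₃ = 3∏(X − ξᵢ)` over
`ℚ̄` and `ψ₃(0) = b₈ = −1`, so `v(3)·∏v(ξᵢ) = 1`; four canonical roots would give
`v(3)⁶ = v(3)^{24−4m}`. [folklore] -/
theorem exists_isRoot_Ψ₃_wild (h1 : W.a₁ = 0) (h3 : W.a₃ = 0) (h4 : W.a₄ = 1) (h6 : W.a₆ = 0)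
    {m : ℕ} (hm1 : 1 ≤ m) (hm4 : m ≤ 4)
    (hα : (placeOver 3).valuation W.a₂ ^ 6 = (placeOver 3).valuation (3 : AlgebraicClosure ℚ) ^ m) :
    ∃ x : AlgebraicClosure ℚ, W.Ψ₃.IsRoot x ∧
      (placeOver 3).valuation x ^ 18 * (placeOver 3).valuation (3 : AlgebraicClosure ℚ) ^ m = 1 := by
  set v := (placeOver 3).valuation with hv
  set t := v (3 : AlgebraicClosure ℚ) with ht
  have ht1 : t < 1 := valuation_three_lt_one
  have ht0 : t ≠ 0 := valuation_three_ne_zero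
  have hW3 : (3 : AlgebraicClosure ℚ) ≠ 0 := by norm_num
  set F := W.Ψ₃ with hF
  by_contra hcon
  simp only [not_exists, not_and] at hcon
  have hcan : ∀ x, F.IsRoot x → v x ^ 6 * t ^ (6 - m) = 1 := fun x hx ↦
    (valuation_dichotomy_of_isRoot_Ψ₃_wild h1 h3 h4 h6 hm1 hm4 hα hx).resolve_left (hcon x hx)
  -- `F = 3 ∏ (X - ξ)` over its roots, `#roots = 4`
  have hsplit := IsAlgClosed.splits F
  have hprod : F = C F.leadingCoeff * (F.roots.map (X - C ·)).prod := hsplit.eq_prod_roots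
  have hdegF : F.natDegree = 4 := by rw [hF]; exact W.natDegree_Ψ₃ hW3
  have hlc : F.leadingCoeff = 3 := by rw [leadingCoeff, hdegF, hF, coeff_Ψ₃]
  have hF0 : F ≠ 0 := by
    intro h0; rw [h0, natDegree_zero] at hdegF; exact absurd hdegF (by norm_num)
  have hcard : Multiset.card F.roots = 4 := by
    rw [← hdegF]; exact (splits_iff_card_roots.mp hsplit)
  -- evaluate at `0`: `−1 = 3 ∏ (−ξ)`
  have hev0 : F.eval 0 = -1 := by
    rw [hF, eval_Ψ₃_of_shape h1 h3 h4 h6]; ring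
  have hev0' : F.eval 0 = 3 * (F.roots.map (fun a ↦ (0 : AlgebraicClosure ℚ) - a)).prod := by
    have := congrArg (eval (0 : AlgebraicClosure ℚ)) hprod
    rw [eval_mul, eval_C, hlc, eval_multiset_prod, Multiset.map_map] at this
    rw [this]
    congr 1
    refine congrArg Multiset.prod (Multiset.map_congr rfl fun a _ ↦ ?_)
    simp
  -- all roots have the same valuation `c`
  obtain ⟨a₀, ha₀⟩ : ∃ a₀, a₀ ∈ F.roots :=
    Multiset.card_pos_iff_exists_mem.mp (by rw [hcard]; norm_num)
  set c := v a₀ with hc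
  have hc6 : c ^ 6 * t ^ (6 - m) = 1 := hcan a₀ ((mem_roots hF0).mp ha₀)
  have hc0 : c ≠ 0 := by
    rintro h0; rw [h0, zero_pow (by norm_num), zero_mul] at hc6; exact zero_ne_one hc6
  have hall : ∀ a ∈ F.roots, v ((0 : AlgebraicClosure ℚ) - a) = c := by
    intro a ha
    rw [zero_sub, Valuation.map_neg]
    have ha6 := hcan a ((mem_roots hF0).mp ha)
    refine pow_left_injective_of_ne_zero (n := 6) (by norm_num) ?_
    exact mul_right_cancel₀ (pow_ne_zero _ ht0) (ha6.trans hc6.symm)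
  have hvprod : v ((F.roots.map (fun a ↦ (0 : AlgebraicClosure ℚ) - a)).prod) = c ^ 4 := by
    rw [map_multiset_prod, Multiset.map_map]
    have : F.roots.map (⇑v ∘ fun a ↦ (0 : AlgebraicClosure ℚ) - a) = F.roots.map (fun _ ↦ c) :=
      Multiset.map_congr rfl fun a ha ↦ hall a ha
    rw [this, Multiset.map_const', Multiset.prod_replicate, hcard]
  -- `1 = t · c⁴`
  have key : t * c ^ 4 = 1 := by
    have := congrArg v hev0'
    rw [hev0, Valuation.map_neg, map_one, map_mul, hvprod] at this
    exact this.symm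
  -- `t⁶ c²⁴ = 1 = c²⁴ t^{24 − 4m}`
  have e1 : t ^ 6 * c ^ 24 = 1 := by
    rw [show (24 : ℕ) = 4 * 6 by norm_num, pow_mul, ← mul_pow, key, one_pow]
  have e2 : c ^ 24 * t ^ ((6 - m) * 4) = 1 := by
    rw [show (24 : ℕ) = 6 * 4 by norm_num, pow_mul, pow_mul, ← mul_pow, hc6, one_pow]
  have e3 : t ^ 6 = t ^ ((6 - m) * 4) := by
    have hc24 : c ^ 24 ≠ 0 := pow_ne_zero _ hc0
    refine mul_right_cancel₀ hc24 ?_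
    rw [e1.trans e2.symm |>.trans (mul_comm _ _)]
  have := pow_injective_of_lt_one' ht0 ht1 e3
  omega

end Three

end Summit.BirchSwinnertonDyer.Rank1Residual.GaloisImage

end
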